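import Summits.ValiantsHypothesis.ValiantsHypothesis.Theorems.LacunarySymmetroidMatrixDescartesDeepEndLawTwo

/-!
# `MatrixDescartes` census — TWO DEEP ENDS at `m = 2`, KIT: the `2 × 2` bookkeeping (two rank-one updates, evaluation, glued points, scaled determinant)

HONEST FRAMING.  Cell `val-V1-extremal` (engine seat val-v1x-eng-6 g4), crux `Theses.LacunarySymmetroid.MatrixDescartes`
(stmt-ValiantsHypothesis-18050).  LOWER-bound / construction mathematics in census (CONJECTURE-A) currency at `m = 2` (outside the crux window);
nothing here bears on the crux, on `DoorA26` / `DoorA34`, or on `VP ≠ VNP`.  No definitions.  Helper mode.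

THE LAW (`exists_alternating_twoDeepEnds`, row form `not_posRootLawAt_twoDeepEnds`).  Core: a `K`-letter real symmetric `2 × 2` pencil `P` with an
`N`-alternation certificate `τ`.  Top datum: `v` and an `M_t`-alternation certificate `σ` of the compression `v ⬝ᵥ adj(P) v = (Jv)ᵀ P (Jv)` ABOVE `τ`.
Bottom datum: `v'` and an `M_b`-alternation certificate `ρ` of `v' ⬝ᵥ adj(P) v'` BELOW `τ`.  Then the `(K+2)`-letter pencil
`μ_b v'v'ᵀ + y^D P(y) + μ_t y^(n₀+2D) v vᵀ` (`n₀` above every `d l`) alternates, for `D` large and suitable `μ_b, μ_t ≠ 0`, along ALL of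
`ρ < τ < σ`: `N + M_t + M_b + 2` alternations; both end letters are rank one, so the tree's two-ended TAIL GRAFT
(`TailGraft.not_posRootLawAt_of_tail_both`) adds two more: **`¬ PosRootLawAt 2 (K+2) (N + M_t + M_b + 3)`** — the census bookkeeping
«record = core + (2 + γ_top) + (2 + γ_bot)» of the `m = 2` rows (`C22 = 13 + 5 + 4`, `GRAFT25 = 16 + 5 + 4`) as ONE theorem with `γ = M` the far
alternations of the two compressions.  Mechanism: for `2 × 2` letters `det(A + p v'v'ᵀ + q v vᵀ) = det A + p·u'(A) + q·u(A) + p q (v × v')²`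
(`det_add_two_rankOne`); with `μ_b = ε_b t_b^D`, `μ_t = ε_t / t_s^(n₀+D)` (`ρ_last < t_b < τ_0`, `τ_N < t_s < σ_0`) every non-leading term dies at
every test point as `D → ∞` (the cross term through `(t_b/t_s)^D`), and the two junction signs are free.  [folklore] throughout.
-/

-- `Summit.ValiantsHypothesis.ValiantsHypothesis.…` repeats a component by the D-0017 layout
-- (single-conjunct summit), which the `dupNamespace` linter flags; the name is mandated.
set_option linter.dupNamespace false

namespace Summit.ValiantsHypothesis.ValiantsHypothesis.Theorems.LacunarySymmetroidMatrixDescartes.Census.DeepEnd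

open Matrix Finset Filter Topology
open scoped BigOperators
open Summit.ValiantsHypothesis.ValiantsHypothesis.Theorems.LacunarySymmetroidMatrixDescartes.Census.Graft
open Summit.ValiantsHypothesis.ValiantsHypothesis.Theorems.LacunarySymmetroidMatrixDescartes.TailGraft
open Summit.ValiantsHypothesis.ValiantsHypothesis.Theorems.MatrixDescartes.Negative (PosRootLawAt)

/-! ### `2 × 2` bookkeeping -/

/-- `det (A + p • v'v'ᵀ + q • v vᵀ) = det A + p·(v' ⬝ᵥ adj A *ᵥ v') + q·(v ⬝ᵥ adj A *ᵥ v) + p q (v 0 v' 1 − v 1 v' 0)²` for `2 × 2` matrices.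
[folklore] -/
theorem det_add_two_rankOne (A : Matrix (Fin 2) (Fin 2) ℝ) (p q : ℝ) (v v' : Fin 2 → ℝ) :
    (A + p • vecMulVec v' v' + q • vecMulVec v v).det
      = A.det + p * (v' ⬝ᵥ (A.adjugate *ᵥ v')) + q * (v ⬝ᵥ (A.adjugate *ᵥ v))
        + p * q * (v 0 * v' 1 - v 1 * v' 0) ^ 2 := by
  rw [Matrix.det_fin_two, Matrix.det_fin_two, Matrix.adjugate_fin_two]
  simp [vecMulVec_apply, Matrix.add_apply, Matrix.smul_apply, dotProduct, mulVec, Fin.sum_univ_two]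
  ring

/-- Value of the two-ended pencil `cons Lb (snoc (shifted core) Lt)` at `y`. [folklore] -/
theorem cons_snoc_eval {K : ℕ} (d : Fin K → ℕ) (S : Fin K → Matrix (Fin 2) (Fin 2) ℝ) (D E : ℕ)
    (Lb Lt : Matrix (Fin 2) (Fin 2) ℝ) (y : ℝ) :
    ∑ l, y ^ (Fin.cons 0 (Fin.snoc (fun l => d l + D) E : Fin (K + 1) → ℕ) : Fin (K + 1 + 1) → ℕ) l •
        (Fin.cons Lb (Fin.snoc S Lt : Fin (K + 1) → Matrix (Fin 2) (Fin 2) ℝ) : Fin (K + 1 + 1) → Matrix (Fin 2) (Fin 2) ℝ) l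
      = Lb + y ^ D • (∑ l, y ^ d l • S l) + y ^ E • Lt := by
  rw [Fin.sum_univ_succ]
  simp only [Fin.cons_zero, Fin.cons_succ, pow_zero, one_smul]
  rw [Fin.sum_univ_castSucc]
  simp only [Fin.snoc_castSucc, Fin.snoc_last]
  rw [Finset.smul_sum, add_assoc]
  congr 2
  refine Finset.sum_congr rfl fun l _ => ?_
  rw [smul_smul, pow_add, mul_comm]

/-- Strictly increasing glue of three real sequences `ρ < τ < σ`. [folklore] -/
theorem strictMono_glue3 {Mb N Mt : ℕ} (ρ : Fin (Mb + 1) → ℝ) (τ : Fin (N + 1) → ℝ) (σ : Fin (Mt + 1) → ℝ)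
    (hρ : StrictMono ρ) (hτ : StrictMono τ) (hσ : StrictMono σ)
    (h1 : ρ (Fin.last Mb) < τ 0) (h2 : τ (Fin.last N) < σ 0) :
    StrictMono (fun j : Fin (Mb + N + Mt + 3) =>
      if h : (j : ℕ) ≤ Mb then ρ ⟨j, Nat.lt_succ_of_le h⟩
      else if h' : (j : ℕ) ≤ Mb + N + 1 then τ ⟨(j : ℕ) - (Mb + 1), by omega⟩
      else σ ⟨(j : ℕ) - (Mb + N + 2), by omega⟩) := by
  intro i j hij
  have hij' : (i : ℕ) < (j : ℕ) := Fin.lt_def.mp hij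
  have hρτ : ∀ (a : Fin (Mb + 1)) (b : Fin (N + 1)), ρ a < τ b := fun a b =>
    lt_of_le_of_lt (hρ.monotone (Fin.le_last a)) (lt_of_lt_of_le h1 (hτ.monotone (Fin.zero_le b)))
  have hτσ : ∀ (a : Fin (N + 1)) (b : Fin (Mt + 1)), τ a < σ b := fun a b =>
    lt_of_le_of_lt (hτ.monotone (Fin.le_last a)) (lt_of_lt_of_le h2 (hσ.monotone (Fin.zero_le b)))
  have hρσ : ∀ (a : Fin (Mb + 1)) (b : Fin (Mt + 1)), ρ a < σ b := fun a b => (hρτ a 0).trans (hτσ 0 b)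
  by_cases hi : (i : ℕ) ≤ Mb
  · by_cases hj : (j : ℕ) ≤ Mb
    · simp only [dif_pos hi, dif_pos hj]; exact hρ (Fin.mk_lt_mk.mpr hij')
    · by_cases hj' : (j : ℕ) ≤ Mb + N + 1
      · simp only [dif_pos hi, dif_neg hj, dif_pos hj']; exact hρτ _ _
      · simp only [dif_pos hi, dif_neg hj, dif_neg hj']; exact hρσ _ _
  · have hj : ¬ (j : ℕ) ≤ Mb := by omega
    by_cases hi' : (i : ℕ) ≤ Mb + N + 1
    · by_cases hj' : (j : ℕ) ≤ Mb + N + 1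
      · simp only [dif_neg hi, dif_pos hi', dif_neg hj, dif_pos hj']
        exact hτ (Fin.mk_lt_mk.mpr (by omega))
      · simp only [dif_neg hi, dif_pos hi', dif_neg hj, dif_neg hj']; exact hτσ _ _
    · have hj' : ¬ (j : ℕ) ≤ Mb + N + 1 := by omega
      simp only [dif_neg hi, dif_neg hi', dif_neg hj, dif_neg hj']
      exact hσ (Fin.mk_lt_mk.mpr (by omega))

/-- The determinant of the two-ended pencil `μ_b v'v'ᵀ + y^D A + μ_t y^(n₀+2D) v vᵀ` with `μ_b = ε_b t_b^D`, `μ_t = ε_t / t_s^(n₀+D)`,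
divided by `y^(2D)`: `det A + ε_b (t_b/y)^D u' + ε_t (y/t_s)^(n₀+D) u + ε_b ε_t c ((y/t_s)^n₀ (t_b/t_s)^D)` with `u = v ⬝ᵥ adj A v`,
`u' = v' ⬝ᵥ adj A v'`, `c = (v 0 v' 1 − v 1 v' 0)²`. [folklore] -/
theorem det_twoEnds_scaled (A : Matrix (Fin 2) (Fin 2) ℝ) (v v' : Fin 2 → ℝ) (εb εt tb ts y : ℝ) (n₀ D : ℕ)
    (hy : 0 < y) (hts : 0 < ts) :
    ((εb * tb ^ D) • vecMulVec v' v' + y ^ D • A + (y ^ (n₀ + 2 * D) * (εt * (ts ^ (n₀ + D))⁻¹)) • vecMulVec v v).det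
      = (y ^ D) ^ 2 * (A.det + εb * (tb / y) ^ D * (v' ⬝ᵥ (A.adjugate *ᵥ v')) + εt * (y / ts) ^ (n₀ + D) * (v ⬝ᵥ (A.adjugate *ᵥ v))
          + εb * εt * (v 0 * v' 1 - v 1 * v' 0) ^ 2 * ((y / ts) ^ n₀ * (tb / ts) ^ D)) := by
  have hy0 : y ≠ 0 := hy.ne'
  have hyD : y ^ D ≠ 0 := pow_ne_zero _ hy0
  have hts0 : ts ≠ 0 := hts.ne'
  have hrw : (εb * tb ^ D) • vecMulVec v' v' + y ^ D • A + (y ^ (n₀ + 2 * D) * (εt * (ts ^ (n₀ + D))⁻¹)) • vecMulVec v v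
      = y ^ D • (A + ((εb * tb ^ D) * (y ^ D)⁻¹) • vecMulVec v' v'
          + ((y ^ (n₀ + 2 * D) * (εt * (ts ^ (n₀ + D))⁻¹)) * (y ^ D)⁻¹) • vecMulVec v v) := by
    rw [smul_add, smul_add, smul_smul, smul_smul]
    have h1 : y ^ D * (εb * tb ^ D * (y ^ D)⁻¹) = εb * tb ^ D := by field_simp
    have h2 : y ^ D * (y ^ (n₀ + 2 * D) * (εt * (ts ^ (n₀ + D))⁻¹) * (y ^ D)⁻¹)
        = y ^ (n₀ + 2 * D) * (εt * (ts ^ (n₀ + D))⁻¹) := by field_simp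
    rw [h1, h2]; abel
  have e1 : εb * tb ^ D * (y ^ D)⁻¹ = εb * (tb / y) ^ D := by rw [div_pow]; ring
  have e2 : y ^ (n₀ + 2 * D) * (εt * (ts ^ (n₀ + D))⁻¹) * (y ^ D)⁻¹ = εt * (y / ts) ^ (n₀ + D) := by
    rw [div_pow]
    have : y ^ (n₀ + 2 * D) = y ^ (n₀ + D) * y ^ D := by rw [← pow_add]; ring_nf
    rw [this]; field_simp
  have e3 : εb * (tb / y) ^ D * (εt * (y / ts) ^ (n₀ + D)) * (v 0 * v' 1 - v 1 * v' 0) ^ 2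
      = εb * εt * (v 0 * v' 1 - v 1 * v' 0) ^ 2 * ((y / ts) ^ n₀ * (tb / ts) ^ D) := by
    have hm : (tb / y) ^ D * (y / ts) ^ D = (tb / ts) ^ D := by
      rw [← mul_pow]; congr 1; field_simp
    rw [pow_add]
    calc εb * (tb / y) ^ D * (εt * ((y / ts) ^ n₀ * (y / ts) ^ D)) * (v 0 * v' 1 - v 1 * v' 0) ^ 2
        = εb * εt * (v 0 * v' 1 - v 1 * v' 0) ^ 2 * ((y / ts) ^ n₀ * ((tb / y) ^ D * (y / ts) ^ D)) := by ring
      _ = εb * εt * (v 0 * v' 1 - v 1 * v' 0) ^ 2 * ((y / ts) ^ n₀ * (tb / ts) ^ D) := by rw [hm]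
  rw [hrw, det_smul, Fintype.card_fin, det_add_two_rankOne, e1, e2, e3]

/-- `cons 0 (snoc (d + D) E)` is strictly increasing when `d` is, `0 < D` and `d l + D < E`. [folklore] -/
theorem strictMono_cons_snoc {K : ℕ} {d : Fin K → ℕ} (hd : StrictMono d) {D : ℕ} (hD : 0 < D) {E : ℕ}
    (hE0 : 0 < E) (hE : ∀ l, d l + D < E) :
    StrictMono (Fin.cons 0 (Fin.snoc (fun l => d l + D) E : Fin (K + 1) → ℕ) : Fin (K + 1 + 1) → ℕ) := by
  have hin : StrictMono (Fin.snoc (fun l => d l + D) E : Fin (K + 1) → ℕ) :=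
    strictMono_snoc (fun i j hij => by simpa using hd hij) hE
  intro i j hij
  induction i using Fin.cases with
  | zero =>
    induction j using Fin.cases with
    | zero => exact absurd hij (lt_irrefl _)
    | succ j =>
      simp only [Fin.cons_zero, Fin.cons_succ]
      induction j using Fin.lastCases with
      | last => simp only [Fin.snoc_last]; exact hE0
      | cast j => simp only [Fin.snoc_castSucc]; omega
  | succ i =>
    induction j using Fin.cases with
    | zero => exact absurd (Fin.lt_def.mp hij) (by simp)
    | succ j =>
      simp only [Fin.cons_succ]
      exact hin (Fin.succ_lt_succ_iff.mp hij)

/-- Symmetry of the letters of `cons Lb (snoc S Lt)`. [folklore] -/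
theorem isSymm_cons_snoc {K : ℕ} {S : Fin K → Matrix (Fin 2) (Fin 2) ℝ} (hS : ∀ l, (S l).IsSymm)
    (Lb Lt : Matrix (Fin 2) (Fin 2) ℝ) (hb : Lb.IsSymm) (ht : Lt.IsSymm) :
    ∀ l, ((Fin.cons Lb (Fin.snoc S Lt : Fin (K + 1) → Matrix (Fin 2) (Fin 2) ℝ) :
      Fin (K + 1 + 1) → Matrix (Fin 2) (Fin 2) ℝ) l).IsSymm := by
  intro l
  induction l using Fin.cases with
  | zero => simp only [Fin.cons_zero]; exact hb
  | succ l =>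
    simp only [Fin.cons_succ]
    induction l using Fin.lastCases with
    | last => simp only [Fin.snoc_last]; exact ht
    | cast i => simp only [Fin.snoc_castSucc]; exact hS i

end Summit.ValiantsHypothesis.ValiantsHypothesis.Theorems.LacunarySymmetroidMatrixDescartes.Census.DeepEnd
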